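import Summits.ResolutionOfSingularities.ResolutionOfSingularities.Theorems.PurelyInseparableDim4ResConeCInfLayerPrime
import Summits.ResolutionOfSingularities.ResolutionOfSingularities.Theorems.PurelyInseparableDim4ResConeCornerWalls
import HarnessLib
import HarnessLib.Audit.Tags

/-!
# Purely inseparable four-folds — the ♯-FLAG of the flagless branch, every prime: isolation's u-axis witness, read after a slot step from a
# regime-R LAYER state, has both slot exponents `≥ 3`, contact exponent `≤ d − 6` and degree `≥ d + 4`; for `d ≤ 6` it IS `x_j³x_i³x_u^{d−2}`
# (cell `res-dim4-pi`, K2(p) lane, power-cone light-pair line, flagless branch, FILE ♯4)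

[OURS · counted 0 · cell `res-dim4-pi` · K2(p) lane (holder res-dim4-p-12 g5); seat res-dim4-p-3 g6 (MEMO `res-dim4-p-3/MEMO-g6-FLAGLESS-SHARP.md` §3
(U♯), §7).]  Nothing here proves K2(p) for any `p`, any TAIL(p, p−1, 3), `NoIsolatedTrap p p`, the Cossart–Jannsen–Saito theorem or resolution of
singularities in dimension ≥ 4 / characteristic `p` — NOT proved.  AI kernel work, weaker than expert review.  Exponent algebra of OUR frame.

F-exponents `(e_j, e_i, e_u, e_f)`; `d + 1 = p`.
* §1 **`exists_uWitness_of_isIsolated`** — an ISOLATED `p`-fold point has a monomial with `e_j + e_i + e_f ≤ d` (the u-AXIS is not `p`-fold;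
  `…CornerWalls.ordAlong_erase_lt_of_isIsolated` read for the free letter `u`).
* §2 **`uWitness_bounds_step_translate_u`** (MEMO (U♯), generic `d`) — parent in REGIME R (`e_f + 2 ≤ d ⇒ e_j ≥ 3 ∧ e_i ≥ 3`) of order `≥ d + 2`
  with `x_j x_i ∣ F`; child of the slot step in the chart of `j` translated by ANY `β·e_u`, IN REGIME and LAYER (no monomial of degree `≤ d + 3` with
  `e_f + 2 ≤ d` except the cone); then every u-witness `E` of the child (`E_j + E_i + E_f ≤ d`) has
  `3 ≤ E_j`, `3 ≤ E_i`, `E_f + 6 ≤ d`, `d + 4 ≤ |E|` and `E_i + E_u + E_f + 2 ≤ E_j + d`.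
* §3 **`uWitness_eq_sharpFlag_of_le_six`** — if moreover `d ≤ 6` (so `d = 6`, `p = 7`) the u-witness IS `x_j³x_i³x_u^{d−2}`: the ♯-flag position is
  UNIQUE, so isolation of every state of an infinite flagless chain at `p = 7` forces `g = coeff x_j³x_i³x_u⁴ ≠ 0` from three steps after the
  first letter change on (♯3 `coeff_sharpFlag_step_translate_u` carries it).  For `d ≥ 7` several positions remain (MEMO §7).
[cite: Hauser2010, §§F–G] [cite: HauserPerlega2019PRIMS, §2 (permissible blowups)] [cite: CossartJannsenSaito2020, Thm. 3.14]
bears_on: LADDER-RESOLUTION:D157-DOOR2 (res-dim4-pi · K2(p) · power cones · flagless branch ♯4).  Supports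
stmt-ResolutionOfSingularities-16155 (helper).
-/

set_option linter.dupNamespace false -- mandated namespace of this single-conjunct summit

noncomputable section

namespace Summit.ResolutionOfSingularities.ResolutionOfSingularities.Theorems.PIDim4

namespace ResCone

open MvPolynomial Finset
open Literature.AlgebraicGeometry.Resolution
open Literature.AlgebraicGeometry.Resolution.CentreBlowup
open Literature.AlgebraicGeometry.Resolution.Hauser2010
open Literature.AlgebraicGeometry.Resolution.HauserPerlega2019

variable {K : Type} [Field K]

section Letters

variable {j i u f : Fin 4} (hji : j ≠ i) (hju : j ≠ u) (hjf : j ≠ f) (hiu : i ≠ u) (hif : i ≠ f) (huf : u ≠ f)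
include hji hju hjf hiu hif huf

/-! ## 1. Isolation's u-axis witness -/

/-- **AN ISOLATED `p`-FOLD POINT HAS A u-WITNESS** (`d + 1 = p`): some monomial has `e_j + e_i + e_f ≤ d` (else the `u`-axis would lie in the
`p`-fold locus). [OURS] [cite: HauserPerlega2019PRIMS, §2 (permissible blowups)] -/
theorem exists_uWitness_of_isIsolated (p : ℕ) {d : ℕ} (hdp : d + 1 = p) {s : State K} (hiso : IsIsolated p s.F) :
    ∃ E ∈ s.F.support, E j + E i + E f ≤ d := by
  obtain ⟨E, hE, hlt⟩ := exists_degIn_lt_of_ordAlong_lt (ordAlong_erase_lt_of_isIsolated hiso u)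
  refine ⟨E, hE, ?_⟩
  have h := degIn_erase_add_apply u E
  have := degree_eq_quad hji hju hjf hiu hif huf E
  omega

/-! ## 2. Where a u-witness can sit after a slot step from a regime-R LAYER state -/

variable [DecidableEq K]

/-- **u-WITNESS BOUNDS** (MEMO (U♯), any `d`; `d + 1 = p`).  Parent `s` of order `≥ d + 2` (`h6`) with `x_j x_i ∣ F`, in REGIME R; child
`s₁` of the slot step in the chart of `j` translated by `β·e_u`, IN REGIME and LAYER: every `E ∈ supp s₁.F` has `d + 4 ≤ |E|`, or `d < E_f + 2`, or
is the cone.  Then a u-witness `E` of `s₁` satisfies `3 ≤ E_j ∧ 3 ≤ E_i ∧ E_f + 6 ≤ d ∧ d + 4 ≤ |E| ∧ E_i + E_u + E_f + 2 ≤ E_j + d`. [OURS]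
[cite: Hauser2010, §§F–G] -/
theorem uWitness_bounds_step_translate_u (p : ℕ) {d : ℕ} (hdp : d + 1 = p) (s : State K)
    (hq : ((p : ℕ) : ℕ∞) ≤ ordAlong Finset.univ s.F) (h6 : ∀ e ∈ s.F.support, d + 2 ≤ e.degree)
    (hr : ∀ e ∈ s.F.support, 1 ≤ e j ∧ 1 ≤ e i)
    (hR : ∀ e ∈ s.F.support, e f + 2 ≤ d → 3 ≤ e j ∧ 3 ≤ e i) (β : K)
    (hlayer₁ : ∀ E ∈ (CentreBlowup.step p Finset.univ j (Function.update (0 : Fin 4 → K) u β) s).F.support,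
      d + 4 ≤ E.degree ∨ d < E f + 2 ∨ E = Finsupp.single j 1 + Finsupp.single i 1 + Finsupp.single u 0 + Finsupp.single f d)
    {E : Fin 4 →₀ ℕ} (hE : E ∈ (CentreBlowup.step p Finset.univ j (Function.update (0 : Fin 4 → K) u β) s).F.support)
    (hwit : E j + E i + E f ≤ d) :
    3 ≤ E j ∧ 3 ≤ E i ∧ E f + 6 ≤ d ∧ d + 4 ≤ E.degree ∧ E i + E u + E f + 2 ≤ E j + d := by
  obtain ⟨δ, hmem, hm, hi, hf, hu⟩ := exists_parent_of_mem_support_step_translate_u hji hju hjf hiu hif huf p s hq β hE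
  have hδq := degree_eq_quad hji hju hjf hiu hif huf δ
  have hEq := degree_eq_quad hji hju hjf hiu hif huf E
  obtain ⟨h1j, h1i⟩ := hr δ hmem
  -- the witness is not the cone and has `E_f + 2 ≤ d` (its two slot exponents are positive)
  have hEi1 : 1 ≤ E i := by rw [← hi]; exact h1i
  have hEj1 : 1 ≤ E j := by
    have h6' := h6 δ hmem
    omega
  have hEf : E f + 2 ≤ d := by omega
  obtain ⟨h3j, h3i⟩ := hR δ hmem (by rw [hf]; exact hEf)
  have hdeg : d + 4 ≤ E.degree := by
    rcases hlayer₁ E hE with h | h | h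
    · exact h
    · omega
    · exfalso
      have := (quad_apply hji hju hjf hiu hif huf 1 1 0 d).2.1
      rw [← h] at this
      omega
  refine ⟨by omega, by omega, by omega, hdeg, by omega⟩

/-! ## 3. `d ≤ 6`: the ♯-flag position is unique -/

/-- **FOR `d ≤ 6` THE u-WITNESS IS THE ♯-FLAG `x_j³x_i³x_u^{d−2}`** (so `d = 6`, `p = 7`): under the hypotheses of `uWitness_bounds_step_translate_u`
the only possible u-witness of the child is `(3, 3, d − 2, 0)`.  With §1: every ISOLATED such child carries the ♯-flag with a non-zero coefficient
`g`, and ♯3 carries `g` along the chain. [OURS] [cite: Hauser2010, §§F–G] -/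
theorem uWitness_eq_sharpFlag_of_le_six (p : ℕ) {d : ℕ} (hdp : d + 1 = p) (hd6 : d ≤ 6) (s : State K)
    (hq : ((p : ℕ) : ℕ∞) ≤ ordAlong Finset.univ s.F) (h6 : ∀ e ∈ s.F.support, d + 2 ≤ e.degree)
    (hr : ∀ e ∈ s.F.support, 1 ≤ e j ∧ 1 ≤ e i)
    (hR : ∀ e ∈ s.F.support, e f + 2 ≤ d → 3 ≤ e j ∧ 3 ≤ e i) (β : K)
    (hlayer₁ : ∀ E ∈ (CentreBlowup.step p Finset.univ j (Function.update (0 : Fin 4 → K) u β) s).F.support,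
      d + 4 ≤ E.degree ∨ d < E f + 2 ∨ E = Finsupp.single j 1 + Finsupp.single i 1 + Finsupp.single u 0 + Finsupp.single f d)
    {E : Fin 4 →₀ ℕ} (hE : E ∈ (CentreBlowup.step p Finset.univ j (Function.update (0 : Fin 4 → K) u β) s).F.support)
    (hwit : E j + E i + E f ≤ d) :
    E = Finsupp.single j 3 + Finsupp.single i 3 + Finsupp.single u (d - 2) + Finsupp.single f 0 := by
  obtain ⟨h3j, h3i, hf6, hdeg, hup⟩ :=
    uWitness_bounds_step_translate_u hji hju hjf hiu hif huf p hdp s hq h6 hr hR β hlayer₁ hE hwit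
  have hEq := degree_eq_quad hji hju hjf hiu hif huf E
  have hEj : E j = 3 := by omega
  have hEi : E i = 3 := by omega
  have hEf : E f = 0 := by omega
  have hEu : E u = d - 2 := by omega
  rw [eq_sum_single_four hji hju hjf hiu hif huf E, hEj, hEi, hEu, hEf]

/-- **COROLLARY (`d ≤ 6`): an ISOLATED in-regime LAYER child of a regime-R parent carries the ♯-flag**: `coeff x_j³x_i³x_u^{d−2} ≠ 0`. [OURS]
[cite: HauserPerlega2019PRIMS, §2 (permissible blowups)] -/
theorem coeff_sharpFlag_ne_zero_of_isIsolated (p : ℕ) {d : ℕ} (hdp : d + 1 = p) (hd6 : d ≤ 6) (s : State K)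
    (hq : ((p : ℕ) : ℕ∞) ≤ ordAlong Finset.univ s.F) (h6 : ∀ e ∈ s.F.support, d + 2 ≤ e.degree)
    (hr : ∀ e ∈ s.F.support, 1 ≤ e j ∧ 1 ≤ e i)
    (hR : ∀ e ∈ s.F.support, e f + 2 ≤ d → 3 ≤ e j ∧ 3 ≤ e i) (β : K)
    (hlayer₁ : ∀ E ∈ (CentreBlowup.step p Finset.univ j (Function.update (0 : Fin 4 → K) u β) s).F.support,
      d + 4 ≤ E.degree ∨ d < E f + 2 ∨ E = Finsupp.single j 1 + Finsupp.single i 1 + Finsupp.single u 0 + Finsupp.single f d)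
    (hiso₁ : IsIsolated p (CentreBlowup.step p Finset.univ j (Function.update (0 : Fin 4 → K) u β) s).F) :
    coeff (Finsupp.single j 3 + Finsupp.single i 3 + Finsupp.single u (d - 2) + Finsupp.single f 0)
      (CentreBlowup.step p Finset.univ j (Function.update (0 : Fin 4 → K) u β) s).F ≠ 0 := by
  obtain ⟨E, hE, hwit⟩ := exists_uWitness_of_isIsolated hji hju hjf hiu hif huf p hdp hiso₁
  rw [← uWitness_eq_sharpFlag_of_le_six hji hju hjf hiu hif huf p hdp hd6 s hq h6 hr hR β hlayer₁ hE hwit]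
  exact mem_support_iff.mp hE

/-! ## 4. Small shades: a regime-R state is never isolated for `d ≤ 5` -/

omit [DecidableEq K] in
/-- **FOR `d ≤ 5` A REGIME-R STATE IS NEVER ISOLATED** (holder's row `not_isIsolated_of_regimeR_of_U_empty`, rulings g5-27/28; eng-w4 g5
SHARP-1 (S3): `U(5) = U(4) = ∅`, 0/720): if every monomial has both slot exponents `≥ 1` and every monomial with `e_f + 2 ≤ d` has both slot
exponents `≥ 3`, isolation's u-witness `e_j + e_i + e_f ≤ d` would need `6 ≤ d`.  So the flagless branch of the K2(7) rows `(2,2)+0` (`d = 5`)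
and `(3,3)+0` (`d = 4`) dies at the regime-R stage (two steps after the first letter change, ♯2b). [OURS]
[cite: HauserPerlega2019PRIMS, §2 (permissible blowups)] -/
theorem not_isIsolated_of_regimeR_of_le_five (p : ℕ) {d : ℕ} (hdp : d + 1 = p) (hd5 : d ≤ 5) {s : State K}
    (hr : ∀ e ∈ s.F.support, 1 ≤ e j ∧ 1 ≤ e i) (hR : ∀ e ∈ s.F.support, e f + 2 ≤ d → 3 ≤ e j ∧ 3 ≤ e i) :
    ¬ IsIsolated p s.F := by
  intro hiso
  obtain ⟨E, hE, hwit⟩ := exists_uWitness_of_isIsolated hji hju hjf hiu hif huf p hdp hiso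
  obtain ⟨h1, h2⟩ := hr E hE
  obtain ⟨h3, h4⟩ := hR E hE (by omega)
  omega

/-! ## 5. The σ-edition: a regime-R σ-state is never isolated when `d ≤ n + 4` -/

omit [DecidableEq K] in
/-- **A REGIME-R σ-STATE IS NEVER ISOLATED** (`σ = (n, n) + 0`, `n + d = p`, `0 < n`, `d ≤ n + 4`; the `1 ↦ n` edition of §4, which is its
case `n = 1`): slot exponents `≥ n` and REGIME R («`e_f + 2 ≤ d ⇒ e_j, e_i ≥ n + 2`») leave no u-witness `e_j + e_i + e_f ≤ p − 1`, so the
state is not isolated.  At `p = 7` this covers `σ = (2,2)+0` (`d = 5`) and `(3,3)+0` (`d = 4`): the flagless branch of these rows dies the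
moment the translated σ-chain reaches regime R — NO window is needed (holder res-dim4-p-12 g5, ruling g5-33 «(σ♭)»). [OURS]
[cite: Hauser2010, §§F–G] [cite: CossartJannsenSaito2020, Thm. 3.14] -/
theorem not_isIsolated_of_regimeR_sigma (p : ℕ) {n d : ℕ} (hσ : n + d = p) (hn : 0 < n) (hdn : d ≤ n + 4) {s : State K}
    (hr : ∀ e ∈ s.F.support, n ≤ e j ∧ n ≤ e i) (hR : ∀ e ∈ s.F.support, e f + 2 ≤ d → n + 2 ≤ e j ∧ n + 2 ≤ e i) :
    ¬ IsIsolated p s.F := by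
  intro hiso
  obtain ⟨E, hE, hlt⟩ := exists_degIn_lt_of_ordAlong_lt (ordAlong_erase_lt_of_isIsolated hiso u)
  have h := degIn_erase_add_apply u E
  have hq := degree_eq_quad hji hju hjf hiu hif huf E
  obtain ⟨h1, h2⟩ := hr E hE
  by_cases hf : E f + 2 ≤ d
  · obtain ⟨h3, h4⟩ := hR E hE hf
    omega
  · omega

end Letters

end ResCone

end Summit.ResolutionOfSingularities.ResolutionOfSingularities.Theorems.PIDim4
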